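import Mathlib
import Summits.ValiantsHypothesis.ValiantsHypothesis.Theorems.BarrierLeverPartitionMinorsHitByVPHiddenStatesPairBlockMatrix

/-!
# Route BarrierLever — item `PartitionMinorsHitByVP` (stmt-ValiantsHypothesis-19717), line `hidden_states`:
# THE PAIR BLOCK — the triple lemma (explicit `0/1` tables)

Helper file (`--supports stmt-ValiantsHypothesis-19717`; cell valiant-natproofs, rung V4, 𝒟-side door (c); prover seat
val-np-p3 gen 20). Bookkeeping `def`s `pairCols`, `indTab`, `Sunflower3`. Closes NO item. Memo HOME/val-np-p3/g20 §4.

THE TRIPLE LEMMA `exists_table_triple`: the PAIR BLOCK `pairCols = ({0}, {1}, {0,1})` of a zero-base piece (points `g, g', g + g'`)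
has a nonsingular `3 × 3` configuration matrix (`PairBlock.cfgMat`) against three distinct monomials `V₁, V₂, V₃` UNLESS they form
a SUNFLOWER WITH SINGLETON PETALS `{C+a, C+b, C+c}` (`Sunflower3`: equal sizes, common part one element smaller; on those the
three points are dependent for every table — a parallelogram on `x^C · linear`). Proof by explicit `0/1` tables `indTab A B`
(`g = 1_A`, `g' = 1_B`; entries `[V ⊆ A]`, `[V ⊆ B]`, `2^{|V ∩ A ∩ B|}·[V ⊆ A ∪ B]`, `cfgMat_indTab_*`) in three cases:
`det_T` (some pairwise intersection is not inside the third set: an upper TRIANGULAR matrix), `det_S` (all pairwise intersections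
equal the core, a petal with ≥ 2 elements: `det = 2^{|V₁|} − 2^{|C|+1}`), `det_E` (an empty petal: `det = −2^{|V₁|}`), glued by row
permutations (`det_cfgMat_perm_ne_zero`). Consequence (next file): the pair block has rank 3 on EVERY family of more than `h`
monomials, the key step of the MATCHING THEOREM.

WHAT THIS IS NOT: no design is proved good here; item 19717 stays OPEN; nothing on crux 14610 or VP ≠ VNP.
-/

set_option linter.dupNamespace false

namespace Summit.ValiantsHypothesis.ValiantsHypothesis.Theorems.BarrierLever.HiddenStates

open Finset Matrix MvPolynomial

noncomputable section

namespace PairBlock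

variable {h K n : ℕ}

/-! ## 2. The pair block and the triple lemma -/

/-- The three columns of the PAIR BLOCK on two states: `{0}`, `{1}`, `{0, 1}` (points `g, g', g + g'`). -/
def pairCols : Fin 3 → Finset (Fin 2) := ![{0}, {1}, {0, 1}]

/-- The `0/1` table: state `0 ↦ 1_A`, state `1 ↦ 1_B`. -/
def indTab (A B : Finset (Fin h)) : Fin 2 → Fin h → ℂ :=
  fun q a => if q = 0 then (if a ∈ A then 1 else 0) else (if a ∈ B then 1 else 0)

/-- A SUNFLOWER WITH SINGLETON PETALS: three sets of equal size whose common part is one element smaller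
(`{C+a, C+b, C+c}`) — exactly the triples on which the pair block is rank-deficient. -/
def Sunflower3 (V₁ V₂ V₃ : Finset (Fin h)) : Prop :=
  V₁.card = V₂.card ∧ V₂.card = V₃.card ∧ (V₁ ∩ V₂ ∩ V₃).card + 1 = V₁.card

section Entries

variable (U : Fin 3 → Finset (Fin h)) (A B : Finset (Fin h))

/-- Column `0` (point `1_A`): entry `[U i ⊆ A]`. -/
theorem cfgMat_indTab_zero (i : Fin 3) :
    cfgMat U pairCols (indTab A B) i 0 = if U i ⊆ A then 1 else 0 := by
  simp only [cfgMat, Matrix.of_apply, pairCols, indTab, Matrix.cons_val_zero, Finset.sum_singleton, if_true]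
  exact Finset.prod_boole

/-- Column `1` (point `1_B`): entry `[U i ⊆ B]`. -/
theorem cfgMat_indTab_one (i : Fin 3) :
    cfgMat U pairCols (indTab A B) i 1 = if U i ⊆ B then 1 else 0 := by
  simp only [cfgMat, Matrix.of_apply, pairCols, indTab, Matrix.cons_val_one, Matrix.cons_val_zero,
    Finset.sum_singleton, Fin.one_eq_zero_iff, OfNat.ofNat_ne_one, if_false]
  exact Finset.prod_boole

/-- Column `2` (point `1_A + 1_B`): entry `∏_{a ∈ U i} ([a ∈ A] + [a ∈ B])`. -/
theorem cfgMat_indTab_two (i : Fin 3) :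
    cfgMat U pairCols (indTab A B) i 2 =
      ∏ a ∈ U i, ((if a ∈ A then (1 : ℂ) else 0) + (if a ∈ B then 1 else 0)) := by
  have h2 : pairCols 2 = ({0, 1} : Finset (Fin 2)) := rfl
  simp only [cfgMat, Matrix.of_apply, h2]
  refine Finset.prod_congr rfl fun a _ => ?_
  rw [Finset.sum_pair (by decide : (0 : Fin 2) ≠ 1)]
  simp [indTab]

/-- The third column vanishes on a row not inside `A ∪ B` … -/
theorem cfgMat_indTab_two_eq_zero {i : Fin 3} (hi : ¬ U i ⊆ A ∪ B) :
    cfgMat U pairCols (indTab A B) i 2 = 0 := by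
  rw [cfgMat_indTab_two]
  obtain ⟨a, haU, ha⟩ := Finset.not_subset.mp hi
  rw [Finset.mem_union, not_or] at ha
  exact Finset.prod_eq_zero haU (by rw [if_neg ha.1, if_neg ha.2, add_zero])

/-- … and equals `2 ^ |U i ∩ (A ∩ B)|` on a row inside `A ∪ B`. -/
theorem cfgMat_indTab_two_eq_pow {i : Fin 3} (hi : U i ⊆ A ∪ B) :
    cfgMat U pairCols (indTab A B) i 2 = 2 ^ (U i ∩ (A ∩ B)).card := by
  classical
  rw [cfgMat_indTab_two]
  have hpt : ∀ a ∈ U i, ((if a ∈ A then (1 : ℂ) else 0) + (if a ∈ B then 1 else 0)) =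
      if a ∈ A ∩ B then 2 else 1 := by
    intro a ha
    have hab := Finset.mem_union.mp (hi ha)
    by_cases hA : a ∈ A <;> by_cases hB : a ∈ B
    · rw [if_pos hA, if_pos hB, if_pos (Finset.mem_inter.mpr ⟨hA, hB⟩)]; norm_num
    · rw [if_pos hA, if_neg hB, if_neg (fun h => hB (Finset.mem_inter.mp h).2)]; norm_num
    · rw [if_neg hA, if_pos hB, if_neg (fun h => hA (Finset.mem_inter.mp h).1)]; norm_num
    · exact absurd hab (by tauto)
  rw [Finset.prod_congr rfl hpt, Finset.prod_ite, Finset.prod_const, Finset.prod_const_one, mul_one,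
    Finset.filter_mem_eq_inter]

/-- … in particular it is nonzero there. -/
theorem cfgMat_indTab_two_ne_zero {i : Fin 3} (hi : U i ⊆ A ∪ B) :
    cfgMat U pairCols (indTab A B) i 2 ≠ 0 := by
  rw [cfgMat_indTab_two_eq_pow U A B hi]
  exact pow_ne_zero _ two_ne_zero

end Entries

/-- **Case T (triangular).** Roles `(V₁, V₂, V₃)` with `V₂ ⊄ V₁`, `V₃ ⊄ V₂`, `V₃ ∩ V₂ ⊄ V₁`; table
`g = 1_{V₁ ∪ (V₃ ∖ V₂)}`, `g' = 1_{V₂}`: the configuration matrix is upper triangular with nonzero diagonal. -/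
theorem det_T (V₁ V₂ V₃ : Finset (Fin h)) (h21 : ¬ V₂ ⊆ V₁) (h32 : ¬ V₃ ⊆ V₂) (h321 : ¬ V₃ ∩ V₂ ⊆ V₁) :
    (cfgMat ![V₁, V₂, V₃] pairCols (indTab (V₁ ∪ (V₃ \ V₂)) V₂)).det ≠ 0 := by
  classical
  set U : Fin 3 → Finset (Fin h) := ![V₁, V₂, V₃] with hU
  set A := V₁ ∪ (V₃ \ V₂) with hA
  set M := cfgMat U pairCols (indTab A V₂) with hM
  have hU0 : U 0 = V₁ := rfl
  have hU1 : U 1 = V₂ := rfl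
  have hU2 : U 2 = V₃ := rfl
  have m00 : M 0 0 = 1 := by
    rw [hM, cfgMat_indTab_zero, hU0, if_pos (Finset.subset_union_left)]
  have m10 : M 1 0 = 0 := by
    rw [hM, cfgMat_indTab_zero, hU1, if_neg]
    intro hsub
    apply h21
    intro x hx
    rcases Finset.mem_union.mp (hsub hx) with h | h
    · exact h
    · exact absurd hx (Finset.mem_sdiff.mp h).2
  have m20 : M 2 0 = 0 := by
    rw [hM, cfgMat_indTab_zero, hU2, if_neg]
    intro hsub
    apply h321
    intro x hx
    obtain ⟨hx3, hx2⟩ := Finset.mem_inter.mp hx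
    rcases Finset.mem_union.mp (hsub hx3) with h | h
    · exact h
    · exact absurd hx2 (Finset.mem_sdiff.mp h).2
  have m11 : M 1 1 = 1 := by
    rw [hM, cfgMat_indTab_one, hU1, if_pos (Finset.Subset.refl _)]
  have m21 : M 2 1 = 0 := by
    rw [hM, cfgMat_indTab_one, hU2, if_neg h32]
  have m22 : M 2 2 ≠ 0 := by
    rw [hM]
    refine cfgMat_indTab_two_ne_zero U A V₂ ?_
    rw [hU2]
    intro x hx
    by_cases hx2 : x ∈ V₂
    · exact Finset.mem_union_right _ hx2
    · exact Finset.mem_union_left _ (Finset.mem_union_right _ (Finset.mem_sdiff.mpr ⟨hx, hx2⟩))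
  rw [Matrix.det_fin_three, m00, m10, m20, m11, m21]
  simpa using m22

/-- **Case S (disjoint petals, a fat petal).** All pairwise intersections lie in the third set, `V₂, V₃ ⊄ V₁`, and the petal of
`V₁` has at least two elements; table `g = 1_{V₁ ∪ V₂}`, `g' = 1_{V₁ ∪ V₃}`: `det = 2^{|V₁|} − 2^{|C|+1} ≠ 0`. -/
theorem det_S (V₁ V₂ V₃ : Finset (Fin h)) (h12 : V₁ ∩ V₂ ⊆ V₃) (h13 : V₁ ∩ V₃ ⊆ V₂) (h23 : V₂ ∩ V₃ ⊆ V₁)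
    (h21 : ¬ V₂ ⊆ V₁) (h31 : ¬ V₃ ⊆ V₁) (hbig : (V₁ ∩ V₂ ∩ V₃).card + 2 ≤ V₁.card) :
    (cfgMat ![V₁, V₂, V₃] pairCols (indTab (V₁ ∪ V₂) (V₁ ∪ V₃))).det ≠ 0 := by
  classical
  set U : Fin 3 → Finset (Fin h) := ![V₁, V₂, V₃] with hU
  set A := V₁ ∪ V₂ with hA
  set B := V₁ ∪ V₃ with hB
  set M := cfgMat U pairCols (indTab A B) with hM
  set C := V₁ ∩ V₂ ∩ V₃ with hC
  have hU0 : U 0 = V₁ := rfl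
  have hU1 : U 1 = V₂ := rfl
  have hU2 : U 2 = V₃ := rfl
  -- the pairwise intersections are `C`
  have hC12 : V₁ ∩ V₂ = C := by
    rw [hC]; ext x; simp only [Finset.mem_inter]
    exact ⟨fun hx => ⟨hx, h12 (Finset.mem_inter.mpr hx)⟩, fun hx => hx.1⟩
  have hC13 : V₁ ∩ V₃ = C := by
    rw [hC]; ext x; simp only [Finset.mem_inter]
    exact ⟨fun hx => ⟨⟨hx.1, h13 (Finset.mem_inter.mpr hx)⟩, hx.2⟩, fun hx => ⟨hx.1.1, hx.2⟩⟩
  have hAB1 : V₁ ∩ (A ∩ B) = V₁ := by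
    ext x; simp only [Finset.mem_inter, hA, hB, Finset.mem_union]; tauto
  have hAB2 : V₂ ∩ (A ∩ B) = C := by
    rw [← hC12]; ext x
    simp only [Finset.mem_inter, hA, hB, Finset.mem_union]
    constructor
    · rintro ⟨hx2, -, h1 | h3⟩
      · exact ⟨h1, hx2⟩
      · exact ⟨h23 (Finset.mem_inter.mpr ⟨hx2, h3⟩), hx2⟩
    · rintro ⟨h1, h2⟩; exact ⟨h2, Or.inl h1, Or.inl h1⟩
  have hAB3 : V₃ ∩ (A ∩ B) = C := by
    rw [← hC13]; ext x
    simp only [Finset.mem_inter, hA, hB, Finset.mem_union]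
    constructor
    · rintro ⟨hx3, h1 | h2, -⟩
      · exact ⟨h1, hx3⟩
      · exact ⟨h23 (Finset.mem_inter.mpr ⟨h2, hx3⟩), hx3⟩
    · rintro ⟨h1, h3⟩; exact ⟨h3, Or.inl h1, Or.inl h1⟩
  have m00 : M 0 0 = 1 := by rw [hM, cfgMat_indTab_zero, hU0, if_pos Finset.subset_union_left]
  have m01 : M 0 1 = 1 := by rw [hM, cfgMat_indTab_one, hU0, if_pos Finset.subset_union_left]
  have s0 : U 0 ⊆ A ∪ B := by
    rw [hU0]; intro x hx; exact Finset.mem_union_left _ (Finset.mem_union_left _ hx)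
  have s1 : U 1 ⊆ A ∪ B := by
    rw [hU1]; intro x hx; exact Finset.mem_union_left _ (Finset.mem_union_right _ hx)
  have s2 : U 2 ⊆ A ∪ B := by
    rw [hU2]; intro x hx; exact Finset.mem_union_right _ (Finset.mem_union_right _ hx)
  have m02 : M 0 2 = 2 ^ V₁.card := by
    rw [hM, cfgMat_indTab_two_eq_pow U A B s0, hU0, hAB1]
  have m10 : M 1 0 = 1 := by rw [hM, cfgMat_indTab_zero, hU1, if_pos Finset.subset_union_right]
  have m11 : M 1 1 = 0 := by
    rw [hM, cfgMat_indTab_one, hU1, if_neg]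
    intro hsub
    obtain ⟨x, hx2, hx1⟩ := Finset.not_subset.mp h21
    rcases Finset.mem_union.mp (hsub hx2) with h | h
    · exact hx1 h
    · exact hx1 (h23 (Finset.mem_inter.mpr ⟨hx2, h⟩))
  have m12 : M 1 2 = 2 ^ C.card := by
    rw [hM, cfgMat_indTab_two_eq_pow U A B s1, hU1, hAB2]
  have m20 : M 2 0 = 0 := by
    rw [hM, cfgMat_indTab_zero, hU2, if_neg]
    intro hsub
    obtain ⟨x, hx3, hx1⟩ := Finset.not_subset.mp h31
    rcases Finset.mem_union.mp (hsub hx3) with h | h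
    · exact hx1 h
    · exact hx1 (h23 (Finset.mem_inter.mpr ⟨h, hx3⟩))
  have m21 : M 2 1 = 1 := by rw [hM, cfgMat_indTab_one, hU2, if_pos Finset.subset_union_right]
  have m22 : M 2 2 = 2 ^ C.card := by
    rw [hM, cfgMat_indTab_two_eq_pow U A B s2, hU2, hAB3]
  rw [Matrix.det_fin_three, m00, m01, m02, m10, m11, m12, m20, m21, m22]
  have hne : (2 : ℂ) ^ V₁.card ≠ 2 ^ (C.card + 1) := by
    -- distinct powers of two are distinct (cf. `ValuativeBoundNegative.two_pow_ne_two_pow`, not imported here)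
    intro h2
    have h' : ((2 ^ V₁.card : ℕ) : ℂ) = ((2 ^ (C.card + 1) : ℕ) : ℂ) := by push_cast; exact h2
    exact absurd (Nat.pow_right_injective (le_refl 2) (Nat.cast_injective h')) (by omega)
  intro h0
  apply hne
  rw [pow_succ]
  linear_combination h0

/-- **Case E (an empty petal).** `V₁ ⊆ V₂`, `V₁ ⊆ V₃`, `V₂ ∩ V₃ ⊆ V₁`, and `V₂, V₃` incomparable; table `g = 1_{V₂}`,
`g' = 1_{V₃}`: `det = −2^{|V₁|}`. -/
theorem det_E (V₁ V₂ V₃ : Finset (Fin h)) (h12 : V₁ ⊆ V₂) (h13 : V₁ ⊆ V₃) (h23 : V₂ ∩ V₃ ⊆ V₁)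
    (h2n3 : ¬ V₂ ⊆ V₃) (h3n2 : ¬ V₃ ⊆ V₂) :
    (cfgMat ![V₁, V₂, V₃] pairCols (indTab V₂ V₃)).det ≠ 0 := by
  classical
  set U : Fin 3 → Finset (Fin h) := ![V₁, V₂, V₃] with hU
  set M := cfgMat U pairCols (indTab V₂ V₃) with hM
  have hU0 : U 0 = V₁ := rfl
  have hU1 : U 1 = V₂ := rfl
  have hU2 : U 2 = V₃ := rfl
  have h231 : V₂ ∩ V₃ = V₁ :=
    Finset.Subset.antisymm h23 (Finset.subset_inter h12 h13)
  have hI1 : V₁ ∩ (V₂ ∩ V₃) = V₁ := by rw [h231, Finset.inter_self]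
  have hI2 : V₂ ∩ (V₂ ∩ V₃) = V₁ := by rw [h231]; exact Finset.inter_eq_right.mpr h12
  have hI3 : V₃ ∩ (V₂ ∩ V₃) = V₁ := by rw [h231]; exact Finset.inter_eq_right.mpr h13
  have m00 : M 0 0 = 1 := by rw [hM, cfgMat_indTab_zero, hU0, if_pos h12]
  have m01 : M 0 1 = 1 := by rw [hM, cfgMat_indTab_one, hU0, if_pos h13]
  have m02 : M 0 2 = 2 ^ V₁.card := by
    rw [hM, cfgMat_indTab_two_eq_pow U V₂ V₃ (by rw [hU0]; exact fun x hx => Finset.mem_union_left _ (h12 hx)),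
      hU0, hI1]
  have m10 : M 1 0 = 1 := by rw [hM, cfgMat_indTab_zero, hU1, if_pos (Finset.Subset.refl _)]
  have m11 : M 1 1 = 0 := by rw [hM, cfgMat_indTab_one, hU1, if_neg h2n3]
  have m12 : M 1 2 = 2 ^ V₁.card := by
    rw [hM, cfgMat_indTab_two_eq_pow U V₂ V₃ (by rw [hU1]; exact Finset.subset_union_left), hU1, hI2]
  have m20 : M 2 0 = 0 := by rw [hM, cfgMat_indTab_zero, hU2, if_neg h3n2]
  have m21 : M 2 1 = 1 := by rw [hM, cfgMat_indTab_one, hU2, if_pos (Finset.Subset.refl _)]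
  have m22 : M 2 2 = 2 ^ V₁.card := by
    rw [hM, cfgMat_indTab_two_eq_pow U V₂ V₃ (by rw [hU2]; exact Finset.subset_union_right), hU2, hI3]
  rw [Matrix.det_fin_three, m00, m01, m02, m10, m11, m12, m20, m21, m22]
  have hne : (2 : ℂ) ^ V₁.card ≠ 0 := pow_ne_zero _ two_ne_zero
  intro h0
  apply hne
  linear_combination -h0

/-- Permuting the three rows does not affect nonsingularity. -/
theorem det_cfgMat_perm_ne_zero {U : Fin 3 → Finset (Fin h)} {g : Fin 2 → Fin h → ℂ} (σ : Equiv.Perm (Fin 3))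
    (hne : (cfgMat (U ∘ σ) pairCols g).det ≠ 0) : (cfgMat U pairCols g).det ≠ 0 := by
  have hsub : cfgMat (U ∘ σ) pairCols g = (cfgMat U pairCols g).submatrix σ id := by
    refine Matrix.ext fun i k => ?_
    simp [cfgMat, Matrix.submatrix_apply]
  rw [hsub, Matrix.det_permute] at hne
  intro h0
  rw [h0, mul_zero] at hne
  exact hne rfl

/-- **THE TRIPLE LEMMA.** For three distinct sets that are not a singleton-petal sunflower, some table makes the
`3 × 3` configuration matrix of the pair block nonsingular. -/
theorem exists_table_triple (V₁ V₂ V₃ : Finset (Fin h)) (d12 : V₁ ≠ V₂) (d13 : V₁ ≠ V₃) (d23 : V₂ ≠ V₃)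
    (hns : ¬ Sunflower3 V₁ V₂ V₃) :
    ∃ g : Fin 2 → Fin h → ℂ, (cfgMat ![V₁, V₂, V₃] pairCols g).det ≠ 0 := by
  classical
  -- permutations of the rows, as compositions with `![V₁, V₂, V₃]`
  have p132 : (![V₁, V₂, V₃] : Fin 3 → Finset (Fin h)) ∘ (Equiv.swap 1 2) = ![V₁, V₃, V₂] := by
    funext i; fin_cases i <;> rfl
  have p213 : (![V₁, V₂, V₃] : Fin 3 → Finset (Fin h)) ∘ (Equiv.swap 0 1) = ![V₂, V₁, V₃] := by
    funext i; fin_cases i <;> rfl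
  have p321 : (![V₁, V₂, V₃] : Fin 3 → Finset (Fin h)) ∘ (Equiv.swap 0 2) = ![V₃, V₂, V₁] := by
    funext i; fin_cases i <;> rfl
  have p231 : (![V₁, V₂, V₃] : Fin 3 → Finset (Fin h)) ∘ ((Equiv.swap 0 1).trans (Equiv.swap 0 2)) = ![V₂, V₃, V₁] := by
    funext i; fin_cases i <;> rfl
  have p312 : (![V₁, V₂, V₃] : Fin 3 → Finset (Fin h)) ∘ ((Equiv.swap 0 2).trans (Equiv.swap 0 1)) = ![V₃, V₁, V₂] := by
    funext i; fin_cases i <;> rfl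
  -- a generic way to conclude from a witness for a permuted triple
  have use : ∀ (σ : Equiv.Perm (Fin 3)) (W : Fin 3 → Finset (Fin h)),
      (![V₁, V₂, V₃] : Fin 3 → Finset (Fin h)) ∘ σ = W →
      (∃ g, (cfgMat W pairCols g).det ≠ 0) → ∃ g, (cfgMat ![V₁, V₂, V₃] pairCols g).det ≠ 0 := by
    intro σ W hW ⟨g, hg⟩
    exact ⟨g, det_cfgMat_perm_ne_zero σ (by rw [hW]; exact hg)⟩
  -- D1: some pairwise intersection is not inside the third set ⇒ triangular case
  by_cases hA : V₂ ∩ V₃ ⊆ V₁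
  swap
  · have h21 : ¬ V₂ ⊆ V₁ := fun h => hA (fun x hx => h (Finset.mem_inter.mp hx).1)
    have h31 : ¬ V₃ ⊆ V₁ := fun h => hA (fun x hx => h (Finset.mem_inter.mp hx).2)
    by_cases h32 : V₃ ⊆ V₂
    · have h23' : ¬ V₂ ⊆ V₃ := fun h => d23 (Finset.Subset.antisymm h h32)
      exact use _ _ p132 ⟨_, det_T V₁ V₃ V₂ h31 h23' hA⟩
    · exact ⟨_, det_T V₁ V₂ V₃ h21 h32 (by rwa [Finset.inter_comm])⟩
  by_cases hB : V₁ ∩ V₃ ⊆ V₂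
  swap
  · have h12 : ¬ V₁ ⊆ V₂ := fun h => hB (fun x hx => h (Finset.mem_inter.mp hx).1)
    have h32 : ¬ V₃ ⊆ V₂ := fun h => hB (fun x hx => h (Finset.mem_inter.mp hx).2)
    by_cases h31 : V₃ ⊆ V₁
    · have h13' : ¬ V₁ ⊆ V₃ := fun h => d13 (Finset.Subset.antisymm h h31)
      exact use _ _ p231 ⟨_, det_T V₂ V₃ V₁ h32 h13' hB⟩
    · refine use _ _ p213 ⟨_, det_T V₂ V₁ V₃ h12 h31 ?_⟩
      rwa [Finset.inter_comm]
  by_cases hC : V₁ ∩ V₂ ⊆ V₃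
  swap
  · have h13 : ¬ V₁ ⊆ V₃ := fun h => hC (fun x hx => h (Finset.mem_inter.mp hx).1)
    have h23 : ¬ V₂ ⊆ V₃ := fun h => hC (fun x hx => h (Finset.mem_inter.mp hx).2)
    by_cases h21 : V₂ ⊆ V₁
    · have h12' : ¬ V₁ ⊆ V₂ := fun h => d12 (Finset.Subset.antisymm h h21)
      refine use _ _ p321 ⟨_, det_T V₃ V₂ V₁ h23 h12' ?_⟩
      exact hC
    · refine use _ _ p312 ⟨_, det_T V₃ V₁ V₂ h13 h21 ?_⟩
      rwa [Finset.inter_comm]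
  -- D2: all pairwise intersections are the common core
  by_cases c12 : V₁ ⊆ V₂
  · have c13 : V₁ ⊆ V₃ := fun x hx => hC (Finset.mem_inter.mpr ⟨hx, c12 hx⟩)
    have h2n3 : ¬ V₂ ⊆ V₃ := fun h => d12 (Finset.Subset.antisymm c12
      (fun x hx => hA (Finset.mem_inter.mpr ⟨hx, h hx⟩)))
    have h3n2 : ¬ V₃ ⊆ V₂ := fun h => d13 (Finset.Subset.antisymm c13
      (fun x hx => hA (Finset.mem_inter.mpr ⟨h hx, hx⟩)))
    exact ⟨_, det_E V₁ V₂ V₃ c12 c13 hA h2n3 h3n2⟩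
  by_cases c13 : V₁ ⊆ V₃
  · exact absurd (fun x hx => hB (Finset.mem_inter.mpr ⟨hx, c13 hx⟩)) c12
  by_cases c21 : V₂ ⊆ V₁
  · have c23 : V₂ ⊆ V₃ := fun x hx => hC (Finset.mem_inter.mpr ⟨c21 hx, hx⟩)
    have h1n3 : ¬ V₁ ⊆ V₃ := c13
    have h3n1 : ¬ V₃ ⊆ V₁ := fun h => d23 (Finset.Subset.antisymm c23
      (fun x hx => hB (Finset.mem_inter.mpr ⟨h hx, hx⟩)))
    refine use _ _ p213 ⟨_, det_E V₂ V₁ V₃ c21 c23 ?_ h1n3 h3n1⟩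
    exact hB
  by_cases c23 : V₂ ⊆ V₃
  · exact absurd (fun x hx => hA (Finset.mem_inter.mpr ⟨hx, c23 hx⟩)) c21
  by_cases c31 : V₃ ⊆ V₁
  · have c32 : V₃ ⊆ V₂ := fun x hx => hB (Finset.mem_inter.mpr ⟨c31 hx, hx⟩)
    have h2n1 : ¬ V₂ ⊆ V₁ := c21
    refine use _ _ p312 ⟨_, det_E V₃ V₁ V₂ c31 c32 ?_ c12 h2n1⟩
    exact hC
  by_cases c32 : V₃ ⊆ V₂
  · exact absurd (fun x hx => hA (Finset.mem_inter.mpr ⟨c32 hx, hx⟩)) c31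
  -- no containments: petals nonempty; a fat petal (case S) or a sunflower (excluded)
  set C := V₁ ∩ V₂ ∩ V₃ with hCdef
  have hCsub1 : C ⊆ V₁ := fun x hx => (Finset.mem_inter.mp (Finset.mem_inter.mp hx).1).1
  have hCsub2 : C ⊆ V₂ := fun x hx => (Finset.mem_inter.mp (Finset.mem_inter.mp hx).1).2
  have hCsub3 : C ⊆ V₃ := fun x hx => (Finset.mem_inter.mp hx).2
  -- each `V_i` strictly contains `C`
  have hlt1 : C.card < V₁.card := by
    refine Finset.card_lt_card (Finset.ssubset_iff_subset_ne.mpr ⟨hCsub1, fun hEq => c12 ?_⟩)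
    rw [← hEq]; exact hCsub2
  have hlt2 : C.card < V₂.card := by
    refine Finset.card_lt_card (Finset.ssubset_iff_subset_ne.mpr ⟨hCsub2, fun hEq => c21 ?_⟩)
    rw [← hEq]; exact hCsub1
  have hlt3 : C.card < V₃.card := by
    refine Finset.card_lt_card (Finset.ssubset_iff_subset_ne.mpr ⟨hCsub3, fun hEq => c31 ?_⟩)
    rw [← hEq]; exact hCsub1
  by_cases b1 : C.card + 2 ≤ V₁.card
  · exact ⟨_, det_S V₁ V₂ V₃ hC hB hA c21 c31 b1⟩
  by_cases b2 : C.card + 2 ≤ V₂.card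
  · refine use _ _ p213 ⟨_, det_S V₂ V₁ V₃ (by rwa [Finset.inter_comm]) hA hB c12 c32 ?_⟩
    have : V₂ ∩ V₁ ∩ V₃ = C := by rw [hCdef, Finset.inter_comm V₂ V₁]
    rw [this]; exact b2
  by_cases b3 : C.card + 2 ≤ V₃.card
  · refine use _ _ p312 ⟨_, det_S V₃ V₁ V₂ (by rwa [Finset.inter_comm]) (by rwa [Finset.inter_comm]) hC c13 c23 ?_⟩
    have : V₃ ∩ V₁ ∩ V₂ = C := by
      rw [hCdef]; ext x; simp only [Finset.mem_inter]; tauto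
    rw [this]; exact b3
  exfalso
  apply hns
  refine ⟨by omega, by omega, ?_⟩
  rw [← hCdef]; omega

end PairBlock

end

end Summit.ValiantsHypothesis.ValiantsHypothesis.Theorems.BarrierLever.HiddenStates
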